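import Summits.BirchSwinnertonDyer.Rank1Residual.P2.CongruentNumberSilentEvenFiveThetaGaloisBookkeeping
import Summits.BirchSwinnertonDyer.Rank1Residual.P2.CongruentNumberSilentEvenFiveThetaDescentAoki
import HarnessLib
import HarnessLib.Audit.Tags

/-!
# Cell «bsd-monsky» (prover-B): route B's display read SENTENCE BY SENTENCE on [TianYuanZhang2017] §3 —
# `thetaCMPrintedSpec` (every conjunct one printed statement on named objects), the kernel theorem
# `thetaCMPrintedSpec ⟹ thetaCMSpec` ((D4), (D5a–d), (D7) DERIVED, no class-field-theoretic symbol left), and the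
# doors: C-P2-1 on `𝒮⁻` from {TYZ §3 sentences, Aoki 1999 Thm. 2.2} — DEFINITIONS + compositions, nothing asserted

HONEST FRAMING (cell `bsd-monsky`, run/shared/lean/pub/bsd-monsky/; README §1: ONE theorem on ONE explicit family of
quadratic twists of the congruent number curve at the prime `2`; not "BSD for rank ≤ 1"; nothing booked until the
cross-family referee passes the written proofs). This file asserts NO arithmetic fact. Route B's one remaining flag of
record (referee B ROUND 245: «thetaGenusPointDatum obligation») is the CM-level display `thetaCMDatum` =
(D1)–(D7) of `P2/…ThetaCMDisplay.lean`, of which the cell's literature seat rated (D4) DERIVED, (D5a) DERIVED, (D5b–d)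
CFT COMPUTATION (CELL) and (D7) DERIVED (CELL) (HOME/lit/THETA-DISPLAYS-CITE-SHEET.md; referee:
HOME/REFEREE-DISPLAYS-ADMISSIBILITY-2.md §2). Here those conjuncts are REPLACED by sentences printed in §3 of the source,
read on named objects of `Gal(ℍ′_N/ℚ)` acting on `A(ℍ′_N)`, and (D4), (D5a–d), (D7) become KERNEL THEOREMS
(`P2/…ThetaGaloisBookkeeping.lean`): `thetaCMPrintedSpec D ⟹ thetaCMSpec D` (`thetaCMSpec_of_thetaCMPrintedSpec`). The
conjuncts of `thetaCMPrintedSpec` and their printed sources (J = journal page, AJM 21 (2017); chunk = arXiv text):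

BLOCK `N = 2pq ≡ 6 (mod 8)` — objects `z_N ∈ A(ℍ′_N)`, `Φ₀ ⊂ Gal(ℍ′_N/ℚ)`, `θ`, `Γ_H = Gal(ℍ′_N/H_N)`, `Γ_{H′} = Gal(ℍ′_N/H′_N)`:
* (N1) = (D1) "Set `Φ₀ = Φ ∩ (2Cl′_n)` … Define `Z(n) := Σ_{t∈Φ₀} f_n(P_n)^t ∈ A(H′_n)`" (J739 = p0011 L53–L58), `z_n = f_n(P_n)`
  (J738), "`(2Cl′_n)/⟨σ⟩ ≅ 2Cl_n`" (J738), "`Φ₀ = {t_i : i = 1, ⋯, g(n)}`" (J759): `Z(N) = Σ_{t∈Φ₀} t·z_N`, `#Φ₀ = g(N)`.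
* (N2) ⊃ (D2) "`K′_n = K_n(i)` (n ≡ 6) … `Cl′_n = Gal(H′_n/K′_n)`" (J738 = p0011 L1–L2), `Φ ⊂ Cl′_n` (J739): `t ∈ Φ₀` fixes `i`, `√−N`.
* (N3) ⊃ (D3) `θ` = a lift to `ℍ′_N` of `σ_{1+ϖ}`, `σ` the Artin map of `K_N` (J738: fixes `√−N`); **Thm. 3.6 (2)** "`z_n^{σ_{1+ϖ}} =
  z_n + τ((1−i)/2)`" (J741 = p0012 L31–L33; displayed modulo `ℤτ(1)` as in (D3), invariant under the display's WLOG
  `im = ±i`, `τ(1/2) = (2, ±4)`, `Z ↦ −Z`) AND its printed consequence "Thus `z_n^{σ²_{1+ϖ}} = z_n + τ(1)`" (J741 = p0012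
  L33; exact: `τ(1) = (0,0)`, and `z ↦ −z` preserves it since `2τ(1) = 0`).
* (N4) "`z_n ∈ A(H′_n)`", `H′_n = H_n(z_n)` (J738–739): `Γ_{H′}` fixes `z_N`; **Prop. 3.2 (2)** "The field `H′_n` is exactly the ring
  class field of conductor `4` over `K_n`" (J738 = p0010 L111–L113) — abelian over `K_n` (and Galois over `ℚ`): the
  commutator of two automorphisms of `ℍ′_N` fixing `√−N` is trivial on `H′_N`, i.e. lies in `Γ_{H′}`.
* (N5) **Prop. 3.2 (2)** "`Gal(H′_n/H_n) ≃ ℤ/4ℤ` is generated by `σ_{1+ϖ}`" (J738): `σ_{1+ϖ}` is trivial on `H_n`: `θ ∈ Γ_H`.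
* (N6) genus theory: "For any decomposition `n = d₁·d₂` with `d₂` positive and odd, we have an unramified quadratic
  extension `K_n(√d₂*)` of `K_n` where `d₂* = (−1)^{(d₂−1)/2}d₂`" (J725 L11–L16) and "the Hilbert class field `H_n` of `K_n`"
  (J738) [= Cox, *Primes of the form x²+ny²*, Thm. 6.1 (i)(ii): the genus field `K(√p₁*, …, √p_r*)` is the maximal unramified
  extension of `K` abelian over `ℚ`]: for `d₂ ∈ {p, q, pq}`, `√p* = √p = i·√−p`, `√q* = √−q`, `√(pq)* = √−pq` lie in `H_N`,
  i.e. are fixed by `Γ_H`.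
* (N7) = (D6) "In the case `n ≡ 7 (mod 8)`, `H′_n = H_n` and thus `Z(n)` is already defined over `L_n`" (J759 = p0020 L62–L63):
  `Z(pq) ∈ A(L_{pq})`, `L_{pq} = K_{pq}(√p*) = ℚ(√p, √−q)` (`q ≡ 3 (8)`); `Z(q) ∈ A(L_q)`, `L_q = K_q` (`q ≡ 7 (8)`) — unchanged.
BLOCK `p ≡ 5 (mod 8)` — objects `z_p ∈ A(ℍ′_N)`, `Φ₀^{(p)}`, `Γ_p = Gal(ℍ′_N/H′_p)` (`H′_p ⊂ ℍ′_N`, J739 p0011 L60–L62), `σ`, `c`: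
* (P1) as (N1) for `n = p`: `Z(p) = Σ_{t∈Φ₀^{(p)}} t·z_p`, `#Φ₀^{(p)} = g(p)`.
* (P2) "`Φ₀ = Φ ∩ (2Cl′_n)`" (J739) and "the subfield of `H′_n` fixed by `2Cl′_n` is `L_n`" (n ≡ 5; J759 = p0020 L55–L56) with
  `L_p = K_p(√p*) = ℚ(i, √p)` ("`L_n(i) = ℚ(i, √d : d | n)`", J759; `[L_p : K_p] = 2^{h₂(p)} = 2`, J725/J738; Cox Thm. 6.1 (ii)):
  `t ∈ Φ₀^{(p)}` fixes `i` and `√p`.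
* (P3) "`z_n ∈ A(H′_n)`" (J739): `Γ_p` fixes `z_p`; `H′_p/ℚ` Galois (`H′_p ⊂ K_p^{ab}`, J738 "`z_n ∈ A(K_n^{ab})`", stable under
  complex conjugation by Thm. 3.6 (1); **Prop. 3.2 (1)** "`H′_n(√2)` is the ring class field of conductor `4` over `K_n`"):
  `Γ_p` is normal; `Cl′_p = Gal(H′_p/K_p)` abelian: commutators of automorphisms fixing `√−p` lie in `Γ_p`.
* (P4) "we have introduced `σ ∈ 2Cl′_n`" (J759 L51): `σ` fixes `L_p`; "Let `σ` be the unique order-two element of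
  `Gal(H′_n/H_n)`" (J738 = p0011 L3–L4): `σ² ∈ Γ_p`; **Prop. 3.2 (1)** "`Gal(H′_n/H_n) ≃ ℤ/2ℤ` is generated by `σ_ϖ²`" and
  **Thm. 3.6 (1)** "Thus `z_n^{σ_{ϖ²/2}} = z_n^{σ_ϖ²} = z_n + τ(1)`" (J741 = p0012 L29): `σ·z_p = z_p + τ(1)` (exact, as in (N3)).
* (P5) "`Φ₀` is a set of representatives of `2Cl_n = (2Cl′_n)/⟨σ⟩` in `2Cl′_n`" (J759 = p0020 L57–L58): every automorphism
  trivial on `L_p` (its restriction lies in `Gal(H′_p/L_p) = 2Cl′_p`, J759) is `≡ t` or `≡ tσ` modulo `Γ_p` for some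
  `t ∈ Φ₀^{(p)}`, and for only one.
* (P6) complex conjugation `c` ("`z̄_n` denotes the complex conjugate of `z_n`", J741): `c(i) = −i`, `c(√−d) = −√−d` (`d ∣ N`),
  `c² = 1`; "`(2P(d₀,d₁))^c = Σ_{t∈Cl_n}(2z̄_n)^{1/t}`" (proof of Lemma 3.15, J750 = p0015 L106–L110): `c` inverts
  `Gal(H′_p/K_p)` [= Cox Lemma 9.3 for the ring class field `H′_p(√2) ⊃ H′_p`]: `ctct ∈ Γ_p` for `t` fixing `√−p`;
  **Thm. 3.6 (1)** "`z̄_n = −z_n + τ(1)`" (J741 = p0012 L28): `c·z_p = −z_p + τ(1)` (exact; `z ↦ −z` preserves it).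

§2 proves `thetaCMPrintedSpec D ⟹ thetaCMSpec D` (hence `thetaCMPrintedDatum ⟹ thetaCMDatum ⟹ thetaGenusPointDatum`):
(D4) from (N2)(N3)(N4) (`thetaPt_comm_of_commutator_mem`); (D5a) `θ(i) = −i` from (N3) (`theta_im_eq_neg_of_thm36`);
(D5c,d) and `θ(√−pq) = √−pq` from (N5)(N6); (D5b) `θ(√−2) = −√−2` from (N3)(D5a)(N6) (`theta_sqrtNeg_two_eq_neg`);
(D7) from (P1)–(P6) (`reflection_sum_thetaPt` = PROOF-B Lemma 5 (B3) in the kernel: `g = (gc)c`, `gc` trivial on `L_p`,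
`c·Z(p) = −Σ_t t⁻¹·z_p + g(p)τ(1)`, `Φ₀⁻¹` and `(gc)Φ₀` again sets of representatives). §3: the doors of
`…ThetaDescentAoki.lean` / `…GenusParity.lean` re-fed with `thetaCMPrintedDatum`: C-P2-1 (both forms) on `𝒮⁻` from
{`thetaCMPrintedDatum`, Aoki Thm. 2.2}, clause (a) from the display ALONE, the `q ≡ 3 (8)` rows, the whole even-five
family from {`hTYZ`, `hGZK`, `hAo`, display}. `thetaCMPrintedDatum` stays tagged `@[conjecture]` (an obligation node:
unproved in the tree; its discharge = constructing `z_n = f_n(P_n)`, `H_n ⊂ H′_n ⊂ ℍ′_n`, the Artin map as OBJECTS —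
the layer `tyz_genusPointData` presupposes); what changed is that NO conjunct is a cell-assembled computation any more.
Nothing booked; no mark moved.

References: HOME/proof/PROOF-B.md (v1.3, PASS ×2) §7 Lemmas 4–5; [TianYuanZhang2017] §2.1 (J725), §3.1 (J738–J739 =
chunks p0010 L99–L115, p0011 L1–L73), Prop. 3.2 (1)(2), Thm. 3.6 (1)(2) (J741 = p0012 L22–L36), proof of Lemma 3.15
(J750 = p0015 L106–L110), proof of Lemma 3.21 (J759 = p0020 L50–L63); D. A. Cox, *Primes of the form x² + ny²*, Thm. 6.1,
Lemma 9.3; [Aoki1999] Thm. 2.2 p. 81; HOME/lit/tyz2017/TYZ2017-STATEMENTS.md (+ ADDENDUM 4); HOME/lit/THETA-DISPLAYS-CITE-SHEET.md;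
HOME/review-bundle/sources/AUX-SOURCES.md §A10, §A12; HOME/lean/ROUTE-B-ENCLOSURE.md.
-/

noncomputable section

open scoped Classical

open WeierstrassCurve WeierstrassCurve.Affine Literature.NumberTheory.EllipticCurves
  Literature.NumberTheory.EllipticCurves.Aoki1999
  Literature.NumberTheory.EllipticCurves.Rank1Residual
  Literature.NumberTheory.EllipticCurves.Rank1Residual.Typed
  Literature.NumberTheory.EllipticCurves.HeathBrown1994
  Literature.NumberTheory.EllipticCurves.HeathBrown1994.Families
  Literature.NumberTheory.EllipticCurves.TianYuanZhang2017
  Literature.NumberTheory.EllipticCurves.TianYuanZhang2017.W2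
  Literature.NumberTheory.QuadraticFields.RedeiReichardt

set_option autoImplicit false

namespace Summit.BirchSwinnertonDyer.Rank1Residual.P2

open ThetaDescent Conjectures

/-! ## §1 The display: TYZ §3 sentences on the CM points of the blocks `N = 2pq` and `p` -/

/-- **Route B's display read sentence by sentence on [TianYuanZhang2017] §3** (see the module docstring for the
locator of every conjunct). Objects (existentially quantified, all inside `Gal(ℍ′_N/ℚ) = (D.H ≃ₐ[ℚ] D.H)` acting on
`A(ℍ′_N)`): the CM point `z_N` and the representative set `Φ₀` of block `N`, the lift `θ` of `σ_{1+ϖ}`, the subgroups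
`Γ_H = Gal(ℍ′_N/H_N)` and `Γ_{H′} = Gal(ℍ′_N/H′_N)`; for block `p`: the CM point `z_p`, the representative set
`Φ₀^{(p)}`, the subgroup `Γ_p = Gal(ℍ′_N/H′_p)`, a lift `σ` of the order-two element `σ_ϖ² ∈ Gal(H′_p/H_p)`, and
complex conjugation `c`. A predicate; nothing asserted.
[cite: TianYuanZhang2017, §3.1 (J738–J739 = p0010 L99–L115, p0011 L1–L73), Prop. 3.2 (1)(2), Thm. 3.6 (1)(2) (J741 = p0012 L22–L36), proof of Lemma 3.15 (J750 = p0015 L106–L110), proof of Lemma 3.21 (J759 = p0020 L55–L62), §2.1 (J725 L11–L16)] -/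
def thetaCMPrintedSpec {p q : ℕ} (D : GenusPointData (2 * (p * q))) : Prop :=
  ∃ (zN : APoint D.H) (Φ₀ : Finset (D.H ≃ₐ[ℚ] D.H)) (θ : D.H ≃ₐ[ℚ] D.H) (ΓH ΓH' : Subgroup (D.H ≃ₐ[ℚ] D.H))
    (zp : APoint D.H) (Φp : Finset (D.H ≃ₐ[ℚ] D.H)) (Γp : Subgroup (D.H ≃ₐ[ℚ] D.H)) (σp cc : D.H ≃ₐ[ℚ] D.H),
    -- ── BLOCK `N = 2pq ≡ 6 (mod 8)` ──
    -- (N1) "Set Φ₀ = Φ ∩ (2Cl′_n) … Define Z(n) := Σ_{t∈Φ₀} f_n(P_n)^t", "(2Cl′_n)/⟨σ⟩ ≅ 2Cl_n", "Φ₀ = {t_i : i = 1,…,g(n)}"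
    (D.Z (2 * (p * q)) = ∑ t ∈ Φ₀, thetaPt D t zN ∧ Φ₀.card = gK (2 * (p * q))) ∧
    -- (N2) "Cl′_n = Gal(H′_n/K′_n)", "K′_n = K_n(i)" (n ≡ 6): every `t ∈ Φ₀ ⊂ Cl′_N` fixes `i` and `√−N`
    (∀ t ∈ Φ₀, t D.im = D.im ∧ t (D.sqrtNeg (2 * (p * q))) = D.sqrtNeg (2 * (p * q))) ∧
    -- (N3) `θ` lifts `σ_{1+ϖ} ∈ Gal(K_N^{ab}/K_N)`; Thm. 3.6 (2) "z_n^{σ_{1+ϖ}} = z_n + τ((1−i)/2)" (mod ℤτ(1), WLOG-invariant)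
    --      "… Thus z_n^{σ²_{1+ϖ}} = z_n + τ(1)"
    (θ (D.sqrtNeg (2 * (p * q))) = D.sqrtNeg (2 * (p * q)) ∧
      (∃ m₀ : ℤ, thetaPt D θ zN = zN + D.tauHalfOneMinusI + m₀ • tauOne) ∧
      thetaPt D θ (thetaPt D θ zN) = zN + tauOne) ∧
    -- (N4) `Γ_{H′} = Gal(ℍ′_N/H′_N)`: "z_n ∈ A(H′_n)"; Prop. 3.2 (2) "H′_n is exactly the ring class field of conductor 4
    --      over K_n" — abelian over `K_N` (commutators of `K_N`-automorphisms restrict trivially to `H′_N`)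
    ((∀ γ ∈ ΓH', thetaPt D γ zN = zN) ∧
      (∀ s t : D.H ≃ₐ[ℚ] D.H, s (D.sqrtNeg (2 * (p * q))) = D.sqrtNeg (2 * (p * q)) →
        t (D.sqrtNeg (2 * (p * q))) = D.sqrtNeg (2 * (p * q)) → s⁻¹ * t⁻¹ * s * t ∈ ΓH')) ∧
    -- (N5) `Γ_H = Gal(ℍ′_N/H_N)`: Prop. 3.2 (2) "Gal(H′_n/H_n) ≃ ℤ/4ℤ is generated by σ_{1+ϖ}" — `θ` is trivial on `H_N`
    θ ∈ ΓH ∧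
    -- (N6) genus theory: "K_n(√d₂*) is an unramified quadratic extension of K_n" (odd d₂ ∣ n; J725), inside the Hilbert
    --      class field `H_N` (J738): `√p* = √p = i√−p`, `√q* = √−q`, `√(pq)* = √−pq` are fixed by `Γ_H`
    (∀ γ ∈ ΓH, γ (D.im * D.sqrtNeg p) = D.im * D.sqrtNeg p ∧ γ (D.sqrtNeg q) = D.sqrtNeg q ∧
      γ (D.sqrtNeg (p * q)) = D.sqrtNeg (p * q)) ∧
    -- (N7) J759 "In the case n ≡ 7 (mod 8), H′_n = H_n and thus Z(n) is already defined over L_n":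
    --      `Z(pq) ∈ A(L_{pq})`, `L_{pq} = ℚ(√p, √−q)` (`q ≡ 3 (8)`) / `Z(q) ∈ A(L_q)`, `L_q = K_q` (`q ≡ 7 (8)`)
    (q % 8 = 3 → ∀ g : D.H ≃ₐ[ℚ] D.H, g (D.im * D.sqrtNeg p) = D.im * D.sqrtNeg p → g (D.sqrtNeg q) = D.sqrtNeg q →
      thetaPt D g (D.Z (p * q)) = D.Z (p * q)) ∧
    (q % 8 = 7 → ∀ g : D.H ≃ₐ[ℚ] D.H, g (D.sqrtNeg q) = D.sqrtNeg q → thetaPt D g (D.Z q) = D.Z q) ∧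
    -- ── BLOCK `p ≡ 5 (mod 8)` ──
    -- (P1) "Z(n) := Σ_{t∈Φ₀} f_n(P_n)^t", "Φ₀ = {t_i : i = 1,…,g(n)}" for `n = p`
    (D.Z p = ∑ t ∈ Φp, thetaPt D t zp ∧ Φp.card = gK p) ∧
    -- (P2) "Φ₀ = Φ ∩ (2Cl′_n)", J759 "the subfield of H′_n fixed by 2Cl′_n is L_n" (n ≡ 5), `L_p = ℚ(i, √p)`:
    --      every `t ∈ Φ₀^{(p)}` fixes `i` and `√p`
    (∀ t ∈ Φp, t D.im = D.im ∧ t (D.im * D.sqrtNeg p) = D.im * D.sqrtNeg p) ∧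
    -- (P3) `Γ_p = Gal(ℍ′_N/H′_p)`: "z_n ∈ A(H′_n)"; `H′_p/ℚ` Galois (ring class field, Prop. 3.2 (1)) — `Γ_p` normal;
    --      `Cl′_p = Gal(H′_p/K_p)` abelian — commutators of `K_p`-automorphisms lie in `Γ_p`
    ((∀ γ ∈ Γp, thetaPt D γ zp = zp) ∧ (∀ g γ : D.H ≃ₐ[ℚ] D.H, γ ∈ Γp → g * γ * g⁻¹ ∈ Γp) ∧
      (∀ s t : D.H ≃ₐ[ℚ] D.H, s (D.sqrtNeg p) = D.sqrtNeg p → t (D.sqrtNeg p) = D.sqrtNeg p →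
        s⁻¹ * t⁻¹ * s * t ∈ Γp)) ∧
    -- (P4) J759 "σ ∈ 2Cl′_n" (fixes `L_p`), J738 "σ the unique order-two element of Gal(H′_n/H_n)" (`σ² = 1` on `H′_p`),
    --      Prop. 3.2 (1) `σ = σ_ϖ²` and Thm. 3.6 (1) "Thus … z_n^{σ_ϖ²} = z_n + τ(1)"
    ((σp D.im = D.im ∧ σp (D.im * D.sqrtNeg p) = D.im * D.sqrtNeg p) ∧ σp * σp ∈ Γp ∧
      thetaPt D σp zp = zp + tauOne) ∧
    -- (P5) J759 "Φ₀ is a set of representatives of 2Cl_n = (2Cl′_n)/⟨σ⟩ in 2Cl′_n": every class `{ḡ, ḡσ̄}` of an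
    --      automorphism `g` trivial on `L_p` meets `Φ₀^{(p)}`, and meets it only once
    ((∀ g : D.H ≃ₐ[ℚ] D.H, g D.im = D.im → g (D.im * D.sqrtNeg p) = D.im * D.sqrtNeg p →
        ∃ t ∈ Φp, g * t⁻¹ ∈ Γp ∨ g * (t * σp)⁻¹ ∈ Γp) ∧
      (∀ t₁ ∈ Φp, ∀ t₂ ∈ Φp, (t₁ * t₂⁻¹ ∈ Γp ∨ t₁ * (t₂ * σp)⁻¹ ∈ Γp) → t₁ = t₂)) ∧
    -- (P6) complex conjugation `c` ("z̄_n denotes the complex conjugate of z_n", J741): `c(i) = −i`, `c(√−d) = −√−d`,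
    --      `c² = 1`; J750 "(2P(d₀,d₁))^c = Σ_{t∈Cl_n}(2z̄_n)^{1/t}" — `c` inverts `Cl′_p = Gal(H′_p/K_p)` (`ctct = 1` on
    --      `H′_p`); Thm. 3.6 (1) "z̄_n = −z_n + τ(1)" (n = p ≡ 5)
    (cc D.im = -D.im ∧ (∀ d ∈ (2 * (p * q)).divisors, cc (D.sqrtNeg d) = -D.sqrtNeg d) ∧ cc * cc = 1 ∧
      (∀ t : D.H ≃ₐ[ℚ] D.H, t (D.sqrtNeg p) = D.sqrtNeg p → cc * t * cc * t ∈ Γp) ∧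
      thetaPt D cc zp = -zp + tauOne)

/-- **Route B's hypothesis package, printed sentence by sentence**, at the pair `(p, q)`: TYZ data `D` for `N = 2pq`
with `D.Printed` and `thetaCMPrintedSpec D`. An obligation node (`@[conjecture]`: unproved in the tree — its
discharge = constructing the CM points `z_n = f_n(P_n)`, the class fields `H_n ⊂ H′_n ⊂ ℍ′_n` and the Artin map as
OBJECTS, the same layer `tyz_genusPointData` presupposes); every conjunct is a statement printed in
[TianYuanZhang2017] §3 (or, (N6), classical genus theory) read on those objects. Implies `thetaCMDatum p q`
(`thetaCMDatum_of_thetaCMPrintedDatum`). [cite: TianYuanZhang2017, §3 (Prop. 3.2, Thm. 3.5, Thm. 3.6, Lemma 3.18, Lemma 3.21 and its proof)] -/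
@[conjecture] def thetaCMPrintedDatum (p q : ℕ) : Prop :=
  ∃ D : GenusPointData (2 * (p * q)), D.Printed ∧ thetaCMPrintedSpec D

/-! ## §2 The printed sentences imply the CM-level display (D1)–(D7) -/

namespace ThetaDescent

variable {n : ℕ}

/-- An automorphism fixing `i` and `i·x` fixes `x`. [cite: TianYuanZhang2017, §3.1 (p0011 L60–L64)] -/
theorem fix_of_fix_im_mul (D : GenusPointData n) (g : D.H ≃ₐ[ℚ] D.H) (hgi : g D.im = D.im) (x : D.H)
    (hfix : g (D.im * x) = D.im * x) : g x = x := by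
  have him0 : D.im ≠ 0 := fun h => by have := D.im_sq; rw [h] at this; norm_num at this
  rw [map_mul, hgi] at hfix
  exact mul_left_cancel₀ him0 hfix

/-- The inverse of an automorphism fixing `x` fixes `x`. [cite: TianYuanZhang2017, §3.1 (p0011 L60–L64)] -/
theorem inv_apply_of_apply_eq (D : GenusPointData n) (g : D.H ≃ₐ[ℚ] D.H) (x : D.H) (h : g x = x) : g⁻¹ x = x := by
  rw [AlgEquiv.aut_inv, AlgEquiv.symm_apply_eq]
  exact h.symm

end ThetaDescent

/-- **`thetaCMPrintedSpec D ⟹ thetaCMSpec D`**: (D1) = (N1); (D2) ⊂ (N2); (D3) ⊂ (N3); (D4) from (N4) by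
`thetaPt_comm_of_commutator_mem`; (D5a) from (N3) by `theta_im_eq_neg_of_thm36`; (D5c,d) from (N5)+(N6); (D5b) from
(N3)+(D5a)+(N6) by `theta_sqrtNeg_two_eq_neg`; (D6) = (N7); (D7) from (P1)–(P6) by `reflection_sum_thetaPt`.
[cite: TianYuanZhang2017, Prop. 3.2 (1)(2), Thm. 3.6 (1)(2), §3.1, proofs of Lemma 3.15 and Lemma 3.21, §2.1 (J725)] -/
theorem thetaCMSpec_of_thetaCMPrintedSpec {p q : ℕ} (hp : p.Prime) (hq : q.Prime)
    (D : GenusPointData (2 * (p * q))) (h : thetaCMPrintedSpec D) : thetaCMSpec D := by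
  obtain ⟨zN, Φ₀, θ, ΓH, ΓH', zp, Φp, Γp, σp, cc, ⟨hZ, hcard⟩, hΦ₀, ⟨hθK, ⟨m₀, h36⟩, h36sq⟩, ⟨hΓH'z, hab⟩, hθH,
    hgenus, hD6I, hD6II, ⟨hZp, hcardp⟩, hΦp, ⟨hΓpz, hΓpn, habp⟩, ⟨⟨hσi, hσrp⟩, hσσ, hσz⟩, ⟨hrep, huniq⟩,
    ⟨hci, hcd, hcc, hdih, hcz⟩⟩ := h
  have hN0 : 2 * (p * q) ≠ 0 := Nat.mul_ne_zero two_ne_zero (Nat.mul_ne_zero hp.ne_zero hq.ne_zero)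
  have hpN : p ∈ (2 * (p * q)).divisors := Nat.mem_divisors.mpr ⟨⟨2 * q, by ring⟩, hN0⟩
  -- (D5a) `θ(i) = −i` from Thm. 3.6 (2)
  have hθi : θ D.im = -D.im := theta_im_eq_neg_of_thm36 D θ zN m₀ h36 h36sq
  -- (D5c), (D5d), `θ(√−pq) = √−pq` from `θ ∈ Gal(ℍ′_N/H_N)` and `√p, √−q, √−pq ∈ H_N`
  obtain ⟨hθrp, hθq, hθpq⟩ := hgenus θ hθH
  -- (D5b) `θ(√−2) = −√−2`
  have hθ2 : θ (D.sqrtNeg 2) = -D.sqrtNeg 2 := theta_sqrtNeg_two_eq_neg hp hq D θ hθK hθi hθpq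
  refine ⟨zN, Φ₀, θ, hZ, hcard, fun t ht => (hΦ₀ t ht).1, hθK, ⟨m₀, h36⟩, ?_, hθi, hθ2, hθrp, hθq, hD6I, hD6II, ?_⟩
  · -- (D4) `t·(θ·z_N) = θ·(t·z_N)` from `Gal(H′_N/K_N)` abelian
    intro t ht
    exact thetaPt_comm_of_commutator_mem D ΓH' zN hΓH'z t θ (hab t θ (hΦ₀ t ht).2 hθK)
  · -- (D7) `g·Z(p) ∈ −Z(p) + ℤτ(1)` for `g|_{L_p} = c|_{L_p}`
    intro _hq3 g hgi hgrp
    have hcp : cc (D.sqrtNeg p) = -D.sqrtNeg p := hcd p hpN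
    -- `F` = "trivial on `L_p = ℚ(i, √p)`"
    let F : (D.H ≃ₐ[ℚ] D.H) → Prop := fun a => a D.im = D.im ∧ a (D.im * D.sqrtNeg p) = D.im * D.sqrtNeg p
    have hFsp : ∀ a, F a → a (D.sqrtNeg p) = D.sqrtNeg p := fun a ha => fix_of_fix_im_mul D a ha.1 _ ha.2
    have hFmul : ∀ a b, F a → F b → F (a * b) := fun a b ha hb =>
      ⟨by rw [AlgEquiv.mul_apply, hb.1, ha.1], by rw [AlgEquiv.mul_apply, hb.2, ha.2]⟩
    have hFinv : ∀ a, F a → F a⁻¹ := fun a ha =>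
      ⟨inv_apply_of_apply_eq D a _ ha.1, inv_apply_of_apply_eq D a _ ha.2⟩
    have hcomm : ∀ s t, F s → F t → s⁻¹ * t⁻¹ * s * t ∈ Γp := fun s t hs ht =>
      habp s t (hFsp s hs) (hFsp t ht)
    have hct : ∀ t, F t → cc * t * cc * t ∈ Γp := fun t ht => hdih t (hFsp t ht)
    have hα : F (g * cc) := by
      refine ⟨?_, ?_⟩
      · rw [AlgEquiv.mul_apply, hci, map_neg, hgi, neg_neg]
      · rw [AlgEquiv.mul_apply, map_mul, hci, hcp, neg_mul_neg, hgrp]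
    have hg : g = g * cc * cc := by rw [mul_assoc, hcc, mul_one]
    obtain ⟨m, hm⟩ := reflection_sum_thetaPt D Γp zp hΓpn hΓpz F hFmul hFinv hcomm ⟨hσi, hσrp⟩ hσσ hσz Φp hΦp
      (fun a ha => hrep a ha.1 ha.2) huniq hcc hct hcz (g * cc) hα
    exact ⟨m, by rw [hZp, hg]; exact hm⟩

/-- **`thetaCMPrintedDatum p q ⟹ thetaCMDatum p q`.** [cite: TianYuanZhang2017, §3] -/
theorem thetaCMDatum_of_thetaCMPrintedDatum {p q : ℕ} (hp : p.Prime) (hq : q.Prime)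
    (h : thetaCMPrintedDatum p q) : thetaCMDatum p q := by
  obtain ⟨D, hD, hP⟩ := h
  exact ⟨D, hD, thetaCMSpec_of_thetaCMPrintedSpec hp hq D hP⟩

/-- **`thetaCMPrintedDatum p q ⟹ thetaGenusPointDatum p q`** (route B's original display `K_B`).
[cite: TianYuanZhang2017, §3] -/
theorem thetaGenusPointDatum_of_thetaCMPrintedDatum {p q : ℕ} (hp : p.Prime) (hq : q.Prime)
    (h : thetaCMPrintedDatum p q) : thetaGenusPointDatum p q :=
  thetaGenusPointDatum_of_thetaCMDatum hp hq (thetaCMDatum_of_thetaCMPrintedDatum hp hq h)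

/-- The family form: the printed display for all `p ≡ 5 (mod 8)`, `q ≡ 3 (mod 4)` gives `K_B` for all such pairs.
[cite: TianYuanZhang2017, §3] -/
theorem thetaDisplay_of_thetaPrinted
    (hΘ : ∀ p q : ℕ, p.Prime → q.Prime → p % 8 = 5 → q % 4 = 3 → thetaCMPrintedDatum p q) :
    ∀ p q : ℕ, p.Prime → q.Prime → p % 8 = 5 → q % 4 = 3 → thetaGenusPointDatum p q :=
  fun p q hp hq hp5 hq4 => thetaGenusPointDatum_of_thetaCMPrintedDatum hp hq (hΘ p q hp hq hp5 hq4)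

/-! ## §3 Doors: C-P2-1 and clause (a) on `𝒮⁻` from {printed TYZ §3 sentences, Aoki 1999 Thm. 2.2} -/

/-- **Clause (a) on `𝒮⁻` from the printed display ALONE**: `ord_{s=1} L(E_{2pq}, s) = 1` for every `(p, q) ∈ 𝒮⁻`
(`g(2pq)` odd is the kernel theorem `odd_gK_two_mul_five_mul_of_jacobiSym_neg`; no Selmer input, no GZK binder —
see `…ThetaDescentRank.lean` for the honest framing of "no GZK binder"). CONDITIONAL on the display; nothing asserted.
[cite: TianYuanZhang2017, Thm. 3.5, Prop. 3.2, Thm. 3.6, Lemma 3.21] -/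
theorem analyticRank_eq_one_sMinus_of_thetaPrinted
    (hΘ : ∀ p q : ℕ, p.Prime → q.Prime → p % 8 = 5 → q % 4 = 3 → thetaCMPrintedDatum p q)
    {p q : ℕ} (hp : p.Prime) (hq : q.Prime) (hp5 : p % 8 = 5) (hq4 : q % 4 = 3) (hj : jacobiSym p q = -1) :
    (congruentNumberCurve (2 * (p * q))).analyticRank = 1 :=
  analyticRank_eq_one_sMinus_of_thetaDisplay (thetaDisplay_of_thetaPrinted hΘ) hp hq hp5 hq4 hj

/-- **C-P2-1, sharper (`Ш_an`-unit) form, on all of `𝒮⁻` from {printed display, Aoki 1999 Thm. 2.2}.**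
CONDITIONAL; nothing asserted. [cite: Aoki1999, Thm. 2.2 p. 81] [cite: TianYuanZhang2017, Thm. 3.5, Prop. 3.2, Thm. 3.6] -/
theorem congruentSilentEvenFiveOrdTwo_of_thetaPrinted_of_aoki
    (hΘ : ∀ p q : ℕ, p.Prime → q.Prime → p % 8 = 5 → q % 4 = 3 → thetaCMPrintedDatum p q)
    (hAo : thm22_card_selmerGroup_two) : CongruentSilentEvenFiveOrdTwo :=
  congruentSilentEvenFiveOrdTwo_of_thetaDisplay_of_aoki (thetaDisplay_of_thetaPrinted hΘ) hAo

/-- **C-P2-1, OBSERVABLE form (`ord_{s=1} L(E_{2pq}, s) = 1 ∧ BSD(E_{2pq}, 2)` on all of `𝒮⁻`), from exactly TWO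
named inputs, BOTH printed: {TYZ §3 sentences (`thetaCMPrintedDatum`), Aoki 1999 Thm. 2.2}** — no `hMe`, no
Rédei–Reichardt, no GZK binder, no Monsky 1990, no Tian-2014 system, and no cell-assembled conjunct in the display.
CONDITIONAL; nothing asserted; no mark moved. [cite: Aoki1999, Thm. 2.2 p. 81] [cite: TianYuanZhang2017, Thm. 3.5, Prop. 3.2, Thm. 3.6, Lemma 3.21] -/
theorem congruentSilentEvenFiveBSDTwo_of_thetaPrinted_of_aoki
    (hΘ : ∀ p q : ℕ, p.Prime → q.Prime → p % 8 = 5 → q % 4 = 3 → thetaCMPrintedDatum p q)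
    (hAo : thm22_card_selmerGroup_two) : CongruentSilentEvenFiveBSDTwo :=
  congruentSilentEvenFiveBSDTwo_of_thetaDisplay_of_aoki (thetaDisplay_of_thetaPrinted hΘ) hAo

/-- **C-P2-1, observable form, from {printed display, `hMe`}** (Heath-Brown 1994 / Monsky's even `2`-Selmer count
instead of Aoki). CONDITIONAL; nothing asserted. [cite: HeathBrown1994SelmerCongruentII, Appendix (Monsky) p. 41 L20–L36]
[cite: TianYuanZhang2017, Thm. 3.5, Prop. 3.2, Thm. 3.6] -/
theorem congruentSilentEvenFiveBSDTwo_of_thetaPrinted_of_monskyEven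
    (hΘ : ∀ p q : ℕ, p.Prime → q.Prime → p % 8 = 5 → q % 4 = 3 → thetaCMPrintedDatum p q)
    (hMe : monsky_card_selmerGroup_two_even) : CongruentSilentEvenFiveBSDTwo :=
  congruentSilentEvenFiveBSDTwo_of_thetaDisplay_of_monskyEven (thetaDisplay_of_thetaPrinted hΘ) hMe

/-- **`ord_{s=1} L(E_{2pq}, s) = 1 ∧ BSD(E_{2pq}, 2)` for every `p ≡ 5 (mod 8)`, `q ≡ 3 (mod 8)`, EITHER symbol**, from
{printed display, Aoki 1999 Thm. 2.2}. CONDITIONAL; nothing asserted. [cite: Aoki1999, Thm. 2.2 p. 81]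
[cite: TianYuanZhang2017, Thm. 3.5, Prop. 3.2, Thm. 3.6] -/
theorem analyticRank_eq_one_and_bsdp_two_three_mod_eight_of_thetaPrinted_of_aoki
    (hΘ : ∀ p q : ℕ, p.Prime → q.Prime → p % 8 = 5 → q % 4 = 3 → thetaCMPrintedDatum p q)
    (hAo : thm22_card_selmerGroup_two) {p q : ℕ} (hp : p.Prime) (hq : q.Prime) (hp5 : p % 8 = 5)
    (hq3 : q % 8 = 3) :
    (congruentNumberCurve (2 * (p * q))).analyticRank = 1 ∧ BSDp (congruentNumberCurve (2 * (p * q))) 2 :=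
  analyticRank_eq_one_and_bsdp_two_three_mod_eight_of_thetaDisplay_of_aoki (thetaDisplay_of_thetaPrinted hΘ) hAo
    hp hq hp5 hq3

/-- **`BSD(E_{2pq}, 2)` for ALL primes `p ≡ 5 (mod 8)`, `q ≡ 3 (mod 4)`** from {`hTYZ`, `hGZK`, Aoki 1999 Thm. 2.2, the
printed display} (Rédei–Reichardt is the tree theorem `redeiReichardt_fourTwoCard_classGroup_holds`). CONDITIONAL on
the four binders; nothing asserted; no mark moved. [cite: TianYuanZhang2017, Thm. 1.2, Thm. 3.5, Prop. 3.2, Thm. 3.6]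
[cite: Aoki1999, Thm. 2.2 p. 81] -/
theorem forall_bsdp_two_congruentNumberCurve_two_mul_five_mul_of_thetaPrinted_of_aoki
    (hTYZ : tyz_genusPointData) (hGZK : rank_eq_analyticRank_of_analyticRank_le_one)
    (hAo : thm22_card_selmerGroup_two)
    (hΘ : ∀ p q : ℕ, p.Prime → q.Prime → p % 8 = 5 → q % 4 = 3 → thetaCMPrintedDatum p q) :
    ∀ p q : ℕ, p.Prime → q.Prime → p % 8 = 5 → q % 4 = 3 →
      BSDp (congruentNumberCurve (2 * (p * q))) 2 :=
  forall_bsdp_two_congruentNumberCurve_two_mul_five_mul_of_thetaDisplay_of_aoki hTYZ hGZK hAo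
    (thetaDisplay_of_thetaPrinted hΘ)

end Summit.BirchSwinnertonDyer.Rank1Residual.P2

end
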